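import Literature.AnabelianGeometry.EtaleTheta.Discharge.Sec2Cor219iiiAtModelChiOfSquares
import Literature.AnabelianGeometry.EtaleTheta.Discharge.Sec2Cor218AdmissibleAutAtModelChi
import HarnessLib

/-!
# [EtTh] Cor. 2.19 (iii) (`ThetaEnvTower.Cor219_iii`) at the Tate model modulo the Cor. 2.18 (i)-type stability clauses ONLY
# (row «COR219III-M1b», the composition; proof-only)

S. Mochizuki, *The Étale Theta Function and its Frobenioid-theoretic Manifestations* [EtTh], Publ. RIMS **45** (2009), §2
Cor. 2.19 (iii) p. 65 [cite: MochizukiEtTh2009, Cor 2.19 (iii) p.65].  Cell `abc-iut`, K-L6 row «COR219III-M1b» (abc-iut-L6-lead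
gen 7/8), seat abc-iut-L1-t6 (gen 5), division (C) of 2026-08-27T04:00Z (the composition).  PROOF-ONLY, no definition / instance /
notation / new named fact; everything consumed BY NAME, nothing restated:
* abc-iut-L1-t6's `cor219_iii_modelχq_of_pointHearts` (p494952) = abc-iut-f-142's level-dependent knit
  `cor219_iii_of_pointHearts_of_sq_of_origin` (p493568; compatible exponents by compactness) at the Tate model with the density
  (D1*) (p488563), the squares hypothesis (abc-iut-w5-d162, p493954) and the origin / open-augmentation inputs discharged;
* abc-iut-w5-d187's point-heart in residue form for EVERY admissible `γ` stabilising `Ker θ|_{Π^tp_X̲̲}`,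
  `exists_zpow_red_comm_eq_discrepancy_modelχq` (p494190; the discrepancy is a square, `Sec2Cor219iiiDiscrepancySquare` p492447,
  and `aug (γ b̂) = 1` from the `Ker θ`-stability, `Sec2Cor218AdmissibleAutDeltaStable` p493789);
* abc-iut-f-142's glue residue form ⇒ value form `exists_exponent_value_of_residue` (p494188) and transport clause (a)
  `exists_transport`.

RESULT.  **`cor219_iii_modelχq_of_thetaKer_stable`**: at `modelχq p i j` (`j` even, every étale-theta datum `E`, the record
`X̲̲`-choice `C.Huu = Huuχq p i j l`, `l` odd, every cyclotome tower), given `Compat`/`Sec2Hyps`/Prop. 1.5 (iii) of the datum and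
ONE root cocycle `f₀` as data, `ThetaEnvTower.Cor219_iii` holds PROVIDED every admissible `(γ, hγ, γ̄, hcompat)` (abc-iut-C-hgal-2's
binder shape, p482618) satisfies the two Cor. 2.18 (i)-type stability clauses (H.a): `γ(Ker θ|_{Π^tp_X̲̲}) = Ker θ|_{Π^tp_X̲̲}` and
`γ(θ⁻¹(l·Δ_Θ)) = θ⁻¹(l·Δ_Θ)` (tower currency).  **`cor219_iii_modelTate_inr_of_thetaKer_stable`**: the same at the datum OF RECORD
`etaleThetaDataχqInr p` over `modelχq p 1 2`, binders = data `l, C, hHuu, τ, f₀` and (H.a) ONLY.  The point used is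
`b₁ := b̂₀²`, `b̂₀ = inl(b̂^{ι(1)})` (equal to the record `b₀ = inl(b̂^{ι(1)²})` of p488563 as an element of `Π^tp_Ÿ̲̲`).

HONEST LABEL: statements about the SEMI-SYNTHETIC stage-2 model of OUR typed §1 interface (binder-discharge evidence), NOT about the
tempered fundamental group of a curve; (H.a) is displayed, not asserted; nothing of [EtTh] (refereed) is asserted for a curve; no
side is taken on [IUTchIII] Cor. 3.12; typed ≠ proved; instantiated ≠ endorsed.
-/

noncomputable section

namespace Literature.AnabelianGeometry.EtaleTheta.SettingModel

open Literature.AnabelianGeometry.SemiGraphs _root_.Function _root_.Topology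

variable (p : ℕ) [Fact p.Prime] (i j : ℤ) (hj : Even j)

set_option synthInstance.maxHeartbeats 200000 in
set_option maxHeartbeats 1600000 in
/-- **`ThetaEnvTower.Cor219_iii` at `modelχq p i j` (record `X̲̲`-choice, `l` odd) modulo the Cor. 2.18 (i)-type stability clauses
(H.a) ONLY** — the composition of `cor219_iii_modelχq_of_pointHearts` (p494952) with abc-iut-w5-d187's residue-form point-heart
`exists_zpow_red_comm_eq_discrepancy_modelχq` (p494190) through abc-iut-f-142's glue `exists_exponent_value_of_residue` (p494188),
at the point `b₁ = b̂₀²`, `b̂₀ = inl(b̂^{ι(1)})`, with `a₀ = inl(â^l)`; one root cocycle `f₀` is taken as data.  The two `set_option`s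
only raise elaboration limits for the nested subtype carriers over the `abbrev` record. [cite: MochizukiEtTh2009, Cor 2.19 (iii) p.65] -/
theorem cor219_iii_modelχq_of_thetaKer_stable {E : (ThetaSetting.modelχq p i j hj).EtaleThetaData} {l : ℕ+}
    (hl : Odd (l : ℕ)) (C : E.DoubleUnderline l) (hHuu : C.Huu = Huuχq p i j l hl) {Es : Set ℕ+}
    (τ : (ThetaSetting.modelχq p i j hj).CyclotomeTower l Es)
    (hC : (ThetaSetting.modelχq p i j hj).Compat) (hS : (ThetaSetting.modelχq p i j hj).Sec2Hyps)
    (h15 : ThetaSetting.Prop15iii E hC)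
    (f₀ : contCocycles (ThetaSetting.modelχq p i j hj).toTheta (ThetaSetting.modelχq p i j hj).DeltaTheta C.GtpYdduu)
    (hf₀ : f₀ ∈ C.rootCocycles hC)
    (Ha : ∀ (γ : (C.thetaEnvTower τ hC hS).PiX ≃ₜ* (C.thetaEnvTower τ hC hS).PiX)
      (_ : (C.thetaEnvTower τ hC hS).PiYdd.map γ.toMulEquiv.toMonoidHom = (C.thetaEnvTower τ hC hS).PiYdd)
      (γμ : ∀ M : Es, (C.thetaEnvTower τ hC hS).mu M ≃* (C.thetaEnvTower τ hC hS).mu M)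
      (_ : ∀ (M : Es) (g : (C.thetaEnvTower τ hC hS).lDeltaTheta) (hg : γ g ∈ (C.thetaEnvTower τ hC hS).lDeltaTheta),
        (C.thetaEnvTower τ hC hS).thetaMod M ⟨γ g, hg⟩ = γμ M ((C.thetaEnvTower τ hC hS).thetaMod M g)),
      ((ThetaSetting.modelχq p i j hj).toTheta.comp C.Huu.subtype).ker.map γ.toMulEquiv.toMonoidHom =
          ((ThetaSetting.modelχq p i j hj).toTheta.comp C.Huu.subtype).ker ∧
      (C.thetaEnvTower τ hC hS).lDeltaTheta.map γ.toMulEquiv.toMonoidHom = (C.thetaEnvTower τ hC hS).lDeltaTheta) :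
    (C.thetaEnvTower τ hC hS).Cor219_iii := by
  -- the points `a₀ = inl(â^l)`, `b̂₀ = inl(b̂^{ι(1)})`, `b₁ = b̂₀²`
  let a₀ : C.Huu := ⟨(SemidirectProduct.inl (gfpOf (FreeGroup.of 0 ^ ((l : ℕ) : ℤ))) : PiTpχq p i j),
    hHuu.ge (inl_gfpOf_zpow_mem_Huuχq p i j l hl)⟩
  let bh : C.Huu := ⟨(SemidirectProduct.inl (bPowGfp (iotaZ (Multiplicative.ofAdd 1))) : PiTpχq p i j),
    hHuu.ge (inl_bPowGfp_mem_Huuχq p i j l hl _)⟩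
  have ha₀ : (ThetaSetting.modelχq p i j hj).aug.toMonoidHom (a₀ : (ThetaSetting.modelχq p i j hj).PiTemp) = 1 :=
    SemidirectProduct.right_inl (N := Gfp) (G := GQp p) (φ := actχq p i j) (gfpOf (FreeGroup.of 0 ^ ((l : ℕ) : ℤ)))
  have hbh : (ThetaSetting.modelχq p i j hj).aug.toMonoidHom (bh : (ThetaSetting.modelχq p i j hj).PiTemp) = 1 :=
    SemidirectProduct.right_inl (N := Gfp) (G := GQp p) (φ := actχq p i j) (bPowGfp (iotaZ (Multiplicative.ofAdd 1)))
  have hdeg : Multiplicative.toAdd (gfpSnd (a₀ : PiTpχq p i j).left) = (((l : ℕ+) : ℕ) : ℤ) := by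
    change Multiplicative.toAdd (gfpSnd ((SemidirectProduct.inl (gfpOf (FreeGroup.of 0 ^ ((l : ℕ) : ℤ))) :
      PiTpχq p i j)).left) = _
    rw [SemidirectProduct.left_inl, toAdd_gfpSnd_gfpOf_zpow]
  have hbh2val : ((bh ^ 2 : C.Huu) : PiTpχq p i j) =
      SemidirectProduct.inl (bPowGfp ((iotaZ (Multiplicative.ofAdd 1)) ^ 2)) := by
    rw [Subgroup.coe_pow, map_pow, map_pow]
  have hb2 : bh ^ 2 ∈ (C.thetaEnvTower τ hC hS).PiYdd := by
    change bh ^ 2 ∈ (ThetaSetting.modelχq p i j hj).GtpYdd.subgroupOf C.Huu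
    rw [Subgroup.mem_subgroupOf, hbh2val]
    exact inl_bPowGfp_sq_mem_GtpYdd_modelχq p i j hj _
  have hyb : yCoordχq p i j (((bh ^ 2 : C.Huu)) : PiTpχq p i j) = (iotaZ (Multiplicative.ofAdd 1)) ^ 2 := by
    rw [hbh2val, yCoordχq_inl_bPowGfp]
  have hb₁ : (ThetaSetting.modelχq p i j hj).aug.toMonoidHom
      ((((⟨bh ^ 2, hb2⟩ : (C.thetaEnvTower τ hC hS).PiYdd) : C.Huu)) : (ThetaSetting.modelχq p i j hj).PiTemp) = 1 := by
    change (ThetaSetting.modelχq p i j hj).aug.toMonoidHom (((bh ^ 2 : C.Huu)) : (ThetaSetting.modelχq p i j hj).PiTemp) = 1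
    rw [Subgroup.coe_pow, map_pow, hbh, one_pow]
  -- `b₁` IS the record point `b₀` of p488563
  have hpt : (⟨⟨(SemidirectProduct.inl (bPowGfp ((iotaZ (Multiplicative.ofAdd 1)) ^ 2)) : PiTpχq p i j),
        hHuu.ge (inl_bPowGfp_mem_Huuχq p i j l hl _)⟩, inl_bPowGfp_sq_mem_GtpYdd_modelχq p i j hj _⟩ :
        (C.thetaEnvTower τ hC hS).PiYdd) = ⟨bh ^ 2, hb2⟩ :=
    Subtype.ext (Subtype.ext hbh2val.symm)
  have H := cor219_iii_modelχq_of_pointHearts p i j hj hl C hHuu τ hC hS h15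
  rw [hpt] at H
  refine H fun γ hγ γμ hcompat => ?_
  obtain ⟨hK, hL⟩ := Ha γ hγ γμ hcompat
  refine ⟨hK, hL, fun γΛ hγΛ => ⟨f₀, hf₀, fun M => ?_⟩⟩
  -- the transport `F = Φ_γ f₀` (clause (a) only) and the residue-form point-heart of abc-iut-w5-d187 at `b₁`
  obtain ⟨F, hF, -, -⟩ := C.exists_transport τ hC hS γ hγ hL γΛ hγΛ f₀ hf₀.1
  have hres := exists_zpow_red_comm_eq_discrepancy_modelχq p i j hj C τ hC hS h15 γ hγ hK hL γΛ hγΛ M (γμ M) (hcompat M)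
    hf₀ F hF a₀ ha₀ hdeg bh hbh hb2 hyb
  have hval := C.exists_exponent_value_of_residue τ hC hS h15 hf₀ a₀ ha₀ ⟨bh ^ 2, hb2⟩ hb₁ M (F (C.inclYdduu ⟨bh ^ 2, hb2⟩))
    hres
  rw [hF] at hval
  exact hval

set_option synthInstance.maxHeartbeats 200000 in
set_option maxHeartbeats 1600000 in
/-- **`ThetaEnvTower.Cor219_iii` for the tower of the étale-theta datum OF RECORD at the Tate instance** (`modelχq p 1 2`,
`η̈^Θ := etaDdχq` along `inr`; record `X̲̲`-choice, `l` odd), with `Compat`, `Sec2Hyps` and Prop. 1.5 (iii) discharged BY NAME —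
binders = data `l, C, hHuu, τ`, one root cocycle `f₀`, and the Cor. 2.18 (i)-type stability clauses (H.a) ONLY.
[cite: MochizukiEtTh2009, Cor 2.19 (iii) p.65] -/
theorem cor219_iii_modelTate_inr_of_thetaKer_stable {l : ℕ+} (hl : Odd (l : ℕ))
    (C : (etaleThetaDataχqInr p).DoubleUnderline l) (hHuu : C.Huu = Huuχq p 1 2 l hl) {Es : Set ℕ+}
    (τ : (ThetaSetting.modelχq p 1 2 even_two).CyclotomeTower l Es)
    (f₀ : contCocycles (ThetaSetting.modelχq p 1 2 even_two).toTheta (ThetaSetting.modelχq p 1 2 even_two).DeltaTheta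
      C.GtpYdduu)
    (hf₀ : f₀ ∈ C.rootCocycles (compat_modelχq p 1 2 even_two))
    (Ha : ∀ (γ : (C.thetaEnvTower τ (compat_modelχq p 1 2 even_two) (ThetaSetting.modelχq_sec2Hyps p 1 2 even_two)).PiX ≃ₜ*
        (C.thetaEnvTower τ (compat_modelχq p 1 2 even_two) (ThetaSetting.modelχq_sec2Hyps p 1 2 even_two)).PiX)
      (_ : (C.thetaEnvTower τ (compat_modelχq p 1 2 even_two) (ThetaSetting.modelχq_sec2Hyps p 1 2 even_two)).PiYdd.map
          γ.toMulEquiv.toMonoidHom =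
        (C.thetaEnvTower τ (compat_modelχq p 1 2 even_two) (ThetaSetting.modelχq_sec2Hyps p 1 2 even_two)).PiYdd)
      (γμ : ∀ M : Es, (C.thetaEnvTower τ (compat_modelχq p 1 2 even_two) (ThetaSetting.modelχq_sec2Hyps p 1 2 even_two)).mu M ≃*
        (C.thetaEnvTower τ (compat_modelχq p 1 2 even_two) (ThetaSetting.modelχq_sec2Hyps p 1 2 even_two)).mu M)
      (_ : ∀ (M : Es) (g : (C.thetaEnvTower τ (compat_modelχq p 1 2 even_two) (ThetaSetting.modelχq_sec2Hyps p 1 2 even_two)).lDeltaTheta)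
        (hg : γ g ∈ (C.thetaEnvTower τ (compat_modelχq p 1 2 even_two) (ThetaSetting.modelχq_sec2Hyps p 1 2 even_two)).lDeltaTheta),
        (C.thetaEnvTower τ (compat_modelχq p 1 2 even_two) (ThetaSetting.modelχq_sec2Hyps p 1 2 even_two)).thetaMod M ⟨γ g, hg⟩ =
          γμ M ((C.thetaEnvTower τ (compat_modelχq p 1 2 even_two) (ThetaSetting.modelχq_sec2Hyps p 1 2 even_two)).thetaMod M g)),
      ((ThetaSetting.modelχq p 1 2 even_two).toTheta.comp C.Huu.subtype).ker.map γ.toMulEquiv.toMonoidHom =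
          ((ThetaSetting.modelχq p 1 2 even_two).toTheta.comp C.Huu.subtype).ker ∧
      (C.thetaEnvTower τ (compat_modelχq p 1 2 even_two) (ThetaSetting.modelχq_sec2Hyps p 1 2 even_two)).lDeltaTheta.map
          γ.toMulEquiv.toMonoidHom =
        (C.thetaEnvTower τ (compat_modelχq p 1 2 even_two) (ThetaSetting.modelχq_sec2Hyps p 1 2 even_two)).lDeltaTheta) :
    (C.thetaEnvTower τ (compat_modelχq p 1 2 even_two) (ThetaSetting.modelχq_sec2Hyps p 1 2 even_two)).Cor219_iii :=
  cor219_iii_modelχq_of_thetaKer_stable p 1 2 even_two hl C hHuu τ (compat_modelχq p 1 2 even_two)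
    (ThetaSetting.modelχq_sec2Hyps p 1 2 even_two) (prop15iii_etaleThetaDataχqInr p _) f₀ hf₀ Ha

end Literature.AnabelianGeometry.EtaleTheta.SettingModel

end
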